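import Literature.AlgebraicGeometry.Motives.UnitaryPeriodDomain
import Literature.AlgebraicGeometry.Motives.WeilTypeComplexStructures
import HarnessLib

/-!
# Signature bookkeeping for Hermitian forms and Deligne's `X⁺` as the type AIII domain

Continuation of `Motives/WeilTypeComplexStructures` (complex structures of Weil type `J` ↔
polarizing planes `W`, van Geemen LNM 1594, 5.5–5.7) and `Motives/UnitaryPeriodDomain` (positive
`p`-planes of the standard Hermitian space of signature `(p, q)` ↔ the unit operator ball).
Here the two are tied together by SIGNATURE bookkeeping (Gohberg–Lancaster–Rodman, *Indefinite
Linear Algebra*, Thm. 2.3.2; van Geemen 5.4–5.5):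

* `SignatureSplitting H`: an `H`-orthogonal splitting `V = V⁺ ⊕ V⁻` into a positive and a negative
  definite subspace ("`H` has signature `(dim V⁺, dim V⁻)`", Sylvester);
* `finrank_le_of_isPosDefOn` / `finrank_le_of_isNegDefOn`: positive (negative) definite subspaces
  have dimension `≤ dim V⁺` (`≤ dim V⁻`) [GLR Thm. 2.3.2];
* `isNegDefOn_orthogonalBilin_of_finrank_eq`: a positive definite `W` of the maximal dimension
  `dim V⁺` has NEGATIVE definite orthogonal complement — van Geemen 5.5 "`H` is positive definite
  on `V₊` and THEREFORE negative definite on `V₋ := V₊^⊥`"; hence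
  `isPolarizingPlane_iff_finrank_eq`: polarizing planes = positive definite subspaces of dimension
  `dim V⁺`;
* the standard space `ℂᵖ × ℂ^q` with `H₀ = ⟪·,·⟫ ⊖ ⟪·,·⟫` as a sesquilinear map
  (`stdHermitianSesqForm`, its splitting `stdSignatureSplitting`), for which polarizing planes are
  exactly the positive `p`-planes of `Motives/UnitaryPeriodDomain` (`isPolarizingPlane_std_iff`),
  so that **the complex structures of Weil type of the standard space are in canonical bijection
  with the type AIII bounded domain** (`stdWeilComplexStructureEquiv :
  {J // IsWeilComplexStructure H₀ J} ≃ unitaryPeriodDomain p q`);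
* transport along an isometry (`IsWeilComplexStructure.conj`, `weilComplexStructureEquivOfIsometry`)
  and, for any `(V, H)` with a unitary frame of signature `(p, q)` (`UnitaryFrame`), the bijection
  `UnitaryFrame.weilComplexStructureEquiv : {J // IsWeilComplexStructure H J} ≃ unitaryPeriodDomain p q`
  — Deligne's `X⁺ ≅ SU(p, q)/S(U(p) × U(q))` realised as the open unit ball of `Hom(ℂᵖ, ℂ^q)`
  (van Geemen 5.8–5.10 for `(p, q) = (n, n)`; Carlson–Müller-Stach–Peters Thm. 16.1.5), in
  particular NON-EMPTY (`UnitaryFrame.nonempty_weilComplexStructure`).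

Everything is proved; no named fact is introduced. Not here: the EXISTENCE of unitary frames for
a non-degenerate Hermitian form (Gram–Schmidt; cf. `Motives/WeilFormRationalSignature` over `ℚ`),
and the topology of `X⁺` (continuity of `Z ↦ J_Z`).

## References

* [vanGeemen1994HodgeAV] B. van Geemen, LNM 1594 (1994), 5.4, 5.5, 5.8–5.10.
* [GohbergLancasterRodman2005] I. Gohberg, P. Lancaster, L. Rodman, *Indefinite Linear Algebra and
  Applications* (2005), §2.3 Thm. 2.3.2, §10.1.
* [Deligne1982HodgeCycles] P. Deligne, LNM 900, proof of Thm. 4.8, p. 49.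
* [CarlsonMullerStachPeters2017] J. Carlson, S. Müller-Stach, C. Peters, *Period Mappings and
  Period Domains*, 2nd ed., Thm. 16.1.5.
-/

noncomputable section

open Module
open scoped ComplexConjugate InnerProductSpace

namespace Literature.AlgebraicGeometry.Motives

variable {V : Type*} [AddCommGroup V] [Module ℂ V]

/-! ### Signature splittings and the dimension bounds -/

/-- An `H`-orthogonal splitting `V = V⁺ ⊕ V⁻` with `H|_{V⁺} > 0`, `H|_{V⁻} < 0`: the datum
"`H` is non-degenerate of signature `(dim V⁺, dim V⁻)`" (Sylvester's law of inertia makes the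
two dimensions independent of the splitting, `finrank_le_of_isPosDefOn`).
[cite: GohbergLancasterRodman2005, §2.3 Thm. 2.3.2] [cite: vanGeemen1994HodgeAV, 5.4] -/
structure SignatureSplitting (H : V →ₗ⋆[ℂ] V →ₗ[ℂ] ℂ) where
  /-- The positive definite summand `V⁺`. -/
  pos : Submodule ℂ V
  /-- The negative definite summand `V⁻`. -/
  neg : Submodule ℂ V
  /-- `H|_{V⁺} > 0`. -/
  isPosDefOn_pos : IsPosDefOn H pos
  /-- `H|_{V⁻} < 0`. -/
  isNegDefOn_neg : IsNegDefOn H neg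
  /-- `V⁻ ⊥ V⁺`. -/
  neg_le_orthogonalBilin : neg ≤ Submodule.orthogonalBilin H pos
  /-- `V = V⁺ + V⁻`. -/
  sup_eq_top : pos ⊔ neg = ⊤

variable {H : V →ₗ⋆[ℂ] V →ₗ[ℂ] ℂ}

/-- A non-negative and a negative definite subspace meet trivially. [cite: GohbergLancasterRodman2005, §2.3 Thm. 2.3.2 (proof)] -/
theorem disjoint_of_nonneg_of_isNegDefOn {W N : Submodule ℂ V} (hW : ∀ x ∈ W, 0 ≤ (H x x).re)
    (hN : IsNegDefOn H N) : Disjoint W N := by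
  rw [Submodule.disjoint_def]
  intro x hxW hxN
  by_contra hne
  exact absurd (hW x hxW) (not_le.2 (hN x hxN hne))

/-- A positive definite and a negative definite subspace meet trivially. [cite: GohbergLancasterRodman2005, §2.3 Thm. 2.3.2 (proof)] -/
theorem disjoint_of_isPosDefOn_of_isNegDefOn {W N : Submodule ℂ V} (hW : IsPosDefOn H W)
    (hN : IsNegDefOn H N) : Disjoint W N :=
  disjoint_of_nonneg_of_isNegDefOn (fun x hx => by
    rcases eq_or_ne x 0 with rfl | h0
    · simp
    · exact (hW x hx h0).le) hN

section FiniteDimensional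

variable [FiniteDimensional ℂ V]

/-- `dim W + dim N ≤ dim V` for `W` non-negative and `N` negative definite.
[cite: GohbergLancasterRodman2005, §2.3 Thm. 2.3.2 (proof)] -/
theorem finrank_add_finrank_le_of_nonneg_of_isNegDefOn {W N : Submodule ℂ V}
    (hW : ∀ x ∈ W, 0 ≤ (H x x).re) (hN : IsNegDefOn H N) :
    finrank ℂ W + finrank ℂ N ≤ finrank ℂ V := by
  have h := Submodule.finrank_sup_add_finrank_inf_eq W N
  rw [(disjoint_of_nonneg_of_isNegDefOn hW hN).eq_bot, finrank_bot, add_zero] at h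
  rw [← h]
  exact Submodule.finrank_le _

/-- `dim V⁺ + dim V⁻ = dim V` for a signature splitting. [cite: GohbergLancasterRodman2005, §2.3 Thm. 2.3.2] -/
theorem SignatureSplitting.finrank_pos_add_finrank_neg (σ : SignatureSplitting H) :
    finrank ℂ σ.pos + finrank ℂ σ.neg = finrank ℂ V := by
  have h := Submodule.finrank_sup_add_finrank_inf_eq σ.pos σ.neg
  rw [(disjoint_of_isPosDefOn_of_isNegDefOn σ.isPosDefOn_pos σ.isNegDefOn_neg).eq_bot, finrank_bot,
    add_zero, σ.sup_eq_top, finrank_top] at h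
  exact h.symm

/-- **Inertia, upper bound**: a non-negative subspace has dimension `≤ dim V⁺`.
[cite: GohbergLancasterRodman2005, §2.3 Thm. 2.3.2] -/
theorem SignatureSplitting.finrank_le_of_nonneg (σ : SignatureSplitting H) {W : Submodule ℂ V}
    (hW : ∀ x ∈ W, 0 ≤ (H x x).re) : finrank ℂ W ≤ finrank ℂ σ.pos := by
  have h1 := finrank_add_finrank_le_of_nonneg_of_isNegDefOn hW σ.isNegDefOn_neg
  have h2 := σ.finrank_pos_add_finrank_neg
  omega

/-- **Inertia**: a positive definite subspace has dimension `≤ dim V⁺`.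
[cite: GohbergLancasterRodman2005, §2.3 Thm. 2.3.2] [cite: vanGeemen1994HodgeAV, 5.4–5.5] -/
theorem SignatureSplitting.finrank_le_of_isPosDefOn (σ : SignatureSplitting H) {W : Submodule ℂ V}
    (hW : IsPosDefOn H W) : finrank ℂ W ≤ finrank ℂ σ.pos :=
  σ.finrank_le_of_nonneg fun x hx => by
    rcases eq_or_ne x 0 with rfl | h0
    · simp
    · exact (hW x hx h0).le

/-- **Inertia**: a negative definite subspace has dimension `≤ dim V⁻`.
[cite: GohbergLancasterRodman2005, §2.3 (after Thm. 2.3.2)] -/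
theorem SignatureSplitting.finrank_le_of_isNegDefOn (σ : SignatureSplitting H)
    {N : Submodule ℂ V} (hN : IsNegDefOn H N) : finrank ℂ N ≤ finrank ℂ σ.neg := by
  have hnn : ∀ x ∈ σ.pos, 0 ≤ (H x x).re := fun x hx => by
    rcases eq_or_ne x 0 with rfl | h0
    · simp
    · exact (σ.isPosDefOn_pos x hx h0).le
  have h1 := finrank_add_finrank_le_of_nonneg_of_isNegDefOn hnn hN
  have h2 := σ.finrank_pos_add_finrank_neg
  omega

/-- **van Geemen 5.5: "positive definite on `V₊` and THEREFORE negative definite on `V₊^⊥`"** — for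
`W` positive definite of the maximal dimension `dim V⁺`, the orthogonal complement `W^⊥` is
negative definite (a vector `v ∈ W^⊥ ∖ 0` with `H(v, v) ≥ 0` would make `W ⊕ ℂv` a non-negative
subspace of dimension `dim V⁺ + 1`). [cite: vanGeemen1994HodgeAV, 5.5]
[cite: GohbergLancasterRodman2005, §2.3 Thm. 2.3.2] -/
theorem SignatureSplitting.isNegDefOn_orthogonalBilin_of_finrank_eq (σ : SignatureSplitting H)
    (hH : H.IsSymm) {W : Submodule ℂ V} (hW : IsPosDefOn H W) (hp : finrank ℂ W = finrank ℂ σ.pos) :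
    IsNegDefOn H (Submodule.orthogonalBilin H W) := by
  intro v hv hv0
  by_contra hge
  rw [not_lt] at hge
  -- `v ∉ W`
  have hvW : v ∉ W := fun hvW => by
    have h0 : H v v = 0 := apply_eq_zero_of_mem_of_mem_orthogonalBilin H hvW hv
    have := hW v hvW hv0
    rw [h0, Complex.zero_re] at this
    exact lt_irrefl _ this
  -- `W ⊕ ℂ v` is non-negative …
  have hnn : ∀ x ∈ W ⊔ (ℂ ∙ v), 0 ≤ (H x x).re := by
    intro x hx
    obtain ⟨w, hw, z, hz, rfl⟩ := Submodule.mem_sup.1 hx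
    obtain ⟨c, rfl⟩ := Submodule.mem_span_singleton.1 hz
    have hwv : H w (c • v) = 0 := by
      rw [sesq_smul_right, apply_eq_zero_of_mem_of_mem_orthogonalBilin H hw hv, mul_zero]
    have hvw : H (c • v) w = 0 := by
      rw [← hH.eq, hwv, map_zero]
    have hww : 0 ≤ (H w w).re := by
      rcases eq_or_ne w 0 with rfl | h0
      · simp
      · exact (hW w hw h0).le
    have hcc : (H (c • v) (c • v)).re = ‖c‖ ^ 2 * (H v v).re := by
      rw [sesq_smul_left, sesq_smul_right, ← mul_assoc, Complex.conj_mul', ← Complex.ofReal_pow,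
        Complex.re_ofReal_mul]
    rw [map_add H, LinearMap.add_apply, map_add, map_add, hwv, hvw, add_zero, zero_add,
      Complex.add_re, hcc]
    exact add_nonneg hww (mul_nonneg (sq_nonneg _) hge)
  -- … of dimension `dim V⁺ + 1`: contradiction.
  have hdim : finrank ℂ ↥(W ⊔ (ℂ ∙ v)) = finrank ℂ W + 1 := by
    have h := Submodule.finrank_sup_add_finrank_inf_eq W (ℂ ∙ v)
    have hinf : W ⊓ (ℂ ∙ v) = ⊥ := by
      rw [eq_bot_iff]
      intro x hx
      obtain ⟨hxW, hxv⟩ := Submodule.mem_inf.1 hx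
      obtain ⟨c, rfl⟩ := Submodule.mem_span_singleton.1 hxv
      rcases eq_or_ne c 0 with rfl | hc
      · simp
      · exact absurd ((Submodule.smul_mem_iff W hc).1 hxW) hvW
    rw [hinf, finrank_bot, add_zero, finrank_span_singleton hv0] at h
    exact h
  have hle := σ.finrank_le_of_nonneg hnn
  omega

/-- **Polarizing planes = positive definite subspaces of dimension `dim V⁺`** (for `H` Hermitian
with a signature splitting). [cite: vanGeemen1994HodgeAV, 5.5] [cite: GohbergLancasterRodman2005, §2.3 Thm. 2.3.2] -/
theorem SignatureSplitting.isPolarizingPlane_iff_finrank_eq (σ : SignatureSplitting H)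
    (hH : H.IsSymm) {W : Submodule ℂ V} :
    IsPolarizingPlane H W ↔ IsPosDefOn H W ∧ finrank ℂ W = finrank ℂ σ.pos := by
  constructor
  · intro hW
    refine ⟨hW.1, le_antisymm (σ.finrank_le_of_isPosDefOn hW.1) ?_⟩
    have h1 := σ.finrank_le_of_isNegDefOn hW.2
    have h2 := finrank_le_finrank_add_finrank_orthogonalBilin H W
    have h3 := σ.finrank_pos_add_finrank_neg
    omega
  · rintro ⟨hW, hp⟩
    exact ⟨hW, σ.isNegDefOn_orthogonalBilin_of_finrank_eq hH hW hp⟩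

end FiniteDimensional

/-! ### Transport along an isometry -/

section Isometry

variable {V' : Type*} [AddCommGroup V'] [Module ℂ V'] {H' : V' →ₗ⋆[ℂ] V' →ₗ[ℂ] ℂ}

/-- Complex structures of Weil type are transported along an isometry `e : (V, H) ≅ (V', H')`:
`J ↦ e J e⁻¹`. [cite: Deligne1982HodgeCycles, proof of Thm. 4.8, p. 49] -/
theorem IsWeilComplexStructure.conj (e : V ≃ₗ[ℂ] V') (he : ∀ x y, H' (e x) (e y) = H x y)
    {J : V →ₗ[ℂ] V} (hJ : IsWeilComplexStructure H J) : IsWeilComplexStructure H' (e.conj J) where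
  sq x := by
    rw [LinearEquiv.conj_apply_apply, LinearEquiv.conj_apply_apply, LinearEquiv.symm_apply_apply,
      hJ.sq, map_neg, LinearEquiv.apply_symm_apply]
  compat x y := by
    rw [LinearEquiv.conj_apply_apply, LinearEquiv.conj_apply_apply, he, hJ.compat,
      ← he (e.symm x) (e.symm y), LinearEquiv.apply_symm_apply, LinearEquiv.apply_symm_apply]
  pos x hx := by
    have hx' : e.symm x ≠ 0 := fun h0 => hx (by simpa using congrArg e h0)
    have h := hJ.pos (e.symm x) hx'
    rwa [← he, LinearEquiv.apply_symm_apply, ← LinearEquiv.conj_apply_apply] at h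

/-- **`X⁺` is functorial in isometries**: `J ↦ e J e⁻¹` is a bijection between the complex
structures of Weil type of isometric Hermitian spaces. [cite: Deligne1982HodgeCycles, proof of Thm. 4.8, p. 49] -/
def weilComplexStructureEquivOfIsometry (e : V ≃ₗ[ℂ] V') (he : ∀ x y, H' (e x) (e y) = H x y) :
    {J : V →ₗ[ℂ] V // IsWeilComplexStructure H J} ≃
      {J' : V' →ₗ[ℂ] V' // IsWeilComplexStructure H' J'} where
  toFun J := ⟨e.conj J.1, J.2.conj e he⟩
  invFun J' := ⟨e.symm.conj J'.1, J'.2.conj e.symm fun x y => by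
    rw [← he, LinearEquiv.apply_symm_apply, LinearEquiv.apply_symm_apply]⟩
  left_inv J := Subtype.ext <| LinearMap.ext fun x => by simp
  right_inv J' := Subtype.ext <| LinearMap.ext fun x => by simp

end Isometry

/-! ### The standard space of signature `(p, q)` -/

section Standard

variable (p q : ℕ)

/-- The standard Hermitian form `H₀((x₁, x₂), (y₁, y₂)) = ⟪x₁, y₁⟫ - ⟪x₂, y₂⟫` of
`Motives/UnitaryPeriodDomain` as a sesquilinear map. [cite: GohbergLancasterRodman2005, §10.1 (10.1.2)] -/
def stdHermitianSesqForm :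
    (EuclideanSpace ℂ (Fin p) × EuclideanSpace ℂ (Fin q)) →ₗ⋆[ℂ]
      (EuclideanSpace ℂ (Fin p) × EuclideanSpace ℂ (Fin q)) →ₗ[ℂ] ℂ :=
  ((innerₛₗ ℂ).comp (LinearMap.fst ℂ _ _)).compl₂ (LinearMap.fst ℂ _ _) -
    ((innerₛₗ ℂ).comp (LinearMap.snd ℂ _ _)).compl₂ (LinearMap.snd ℂ _ _)

variable {p q} in
/-- `stdHermitianSesqForm p q x y = ⟪x₁, y₁⟫ - ⟪x₂, y₂⟫ = stdHermitianForm p q x y`.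
[cite: GohbergLancasterRodman2005, §10.1 (10.1.2)] -/
@[simp]
theorem stdHermitianSesqForm_apply (x y : EuclideanSpace ℂ (Fin p) × EuclideanSpace ℂ (Fin q)) :
    stdHermitianSesqForm p q x y = stdHermitianForm p q x y := by
  simp [stdHermitianSesqForm, stdHermitianForm]

/-- `H₀` is Hermitian. [cite: GohbergLancasterRodman2005, §10.1 (10.1.2)] -/
theorem isSymm_stdHermitianSesqForm : (stdHermitianSesqForm p q).IsSymm :=
  ⟨fun x y => by simp [stdHermitianForm, map_sub]⟩

/-- The standard signature splitting `ℂᵖ × ℂ^q = (ℂᵖ × 0) ⊕ (0 × ℂ^q)`.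
[cite: GohbergLancasterRodman2005, §2.3 Thm. 2.3.2 (proof) and §10.1] -/
def stdSignatureSplitting : SignatureSplitting (stdHermitianSesqForm p q) where
  pos := LinearMap.range (LinearMap.inl ℂ (EuclideanSpace ℂ (Fin p)) (EuclideanSpace ℂ (Fin q)))
  neg := LinearMap.range (LinearMap.inr ℂ (EuclideanSpace ℂ (Fin p)) (EuclideanSpace ℂ (Fin q)))
  isPosDefOn_pos := by
    rintro x ⟨y, rfl⟩ hx
    have hy : y ≠ 0 := fun h => hx (by simp [h])
    simp only [stdHermitianSesqForm_apply, stdHermitianForm, LinearMap.inl_apply, inner_zero_right,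
      sub_zero]
    rw [← @RCLike.re_to_complex, inner_self_eq_norm_sq (𝕜 := ℂ)]
    positivity
  isNegDefOn_neg := by
    rintro x ⟨y, rfl⟩ hx
    have hy : y ≠ 0 := fun h => hx (by simp [h])
    simp only [stdHermitianSesqForm_apply, stdHermitianForm, LinearMap.inr_apply, inner_zero_right,
      zero_sub, Complex.neg_re, neg_lt_zero]
    rw [← @RCLike.re_to_complex, inner_self_eq_norm_sq (𝕜 := ℂ)]
    positivity
  neg_le_orthogonalBilin := by
    rintro x ⟨y, rfl⟩
    rw [Submodule.mem_orthogonalBilin_iff]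
    rintro n ⟨z, rfl⟩
    simp [stdHermitianForm]
  sup_eq_top := LinearMap.sup_range_inl_inr

/-- `dim (ℂᵖ × 0) = p`. [cite: GohbergLancasterRodman2005, §2.3 Thm. 2.3.2] -/
theorem finrank_stdSignatureSplitting_pos : finrank ℂ (stdSignatureSplitting p q).pos = p := by
  change finrank ℂ (LinearMap.range (LinearMap.inl ℂ _ _)) = p
  rw [LinearMap.finrank_range_of_inj LinearMap.inl_injective, finrank_euclideanSpace_fin]

variable {p q}

/-- Positive definite subspaces of the standard sesquilinear space are the `H₀`-positive subspaces
of `Motives/UnitaryPeriodDomain`. [cite: GohbergLancasterRodman2005, §10.1 Lemma 10.1.2] -/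
theorem isPosDefOn_std_iff {M : Submodule ℂ (EuclideanSpace ℂ (Fin p) × EuclideanSpace ℂ (Fin q))} :
    IsPosDefOn (stdHermitianSesqForm p q) M ↔ IsPositiveSubspace p q M := by
  simp only [IsPosDefOn, IsPositiveSubspace, stdHermitianSesqForm_apply]

/-- **Polarizing planes of the standard space = positive `p`-planes.**
[cite: vanGeemen1994HodgeAV, 5.5] [cite: GohbergLancasterRodman2005, §2.3 Thm. 2.3.2 and §10.1 Cor. 10.1.4] -/
theorem isPolarizingPlane_std_iff
    {M : Submodule ℂ (EuclideanSpace ℂ (Fin p) × EuclideanSpace ℂ (Fin q))} :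
    IsPolarizingPlane (stdHermitianSesqForm p q) M ↔ IsPositivePlane p q M := by
  rw [(stdSignatureSplitting p q).isPolarizingPlane_iff_finrank_eq (isSymm_stdHermitianSesqForm p q),
    finrank_stdSignatureSplitting_pos, isPosDefOn_std_iff, IsPositivePlane]

variable (p q) in
/-- **Complex structures of Weil type of the standard space of signature `(p, q)` ≃ the type AIII
bounded domain** `{Z : ℂᵖ →L ℂ^q, ‖Z‖ < 1}`: `J ↦ ker(J - i) = graph Z`.
[cite: vanGeemen1994HodgeAV, 5.5–5.10] [cite: CarlsonMullerStachPeters2017, Thm. 16.1.5 (type AIII)] -/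
def stdWeilComplexStructureEquiv :
    {J : _ →ₗ[ℂ] _ // IsWeilComplexStructure (stdHermitianSesqForm p q) J} ≃ unitaryPeriodDomain p q :=
  (weilComplexStructureEquiv (isSymm_stdHermitianSesqForm p q)).trans <|
    (Equiv.subtypeEquivRight fun _ => isPolarizingPlane_std_iff).trans (unitaryPeriodDomainEquiv p q).symm

/-- Along `stdWeilComplexStructureEquiv`, the `i`-eigenspace of `J` is the graph of its image `Z`.
[cite: vanGeemen1994HodgeAV, 5.7] [cite: GohbergLancasterRodman2005, §10.1 Cor. 10.1.4] -/
theorem graphPlane_stdWeilComplexStructureEquiv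
    (J : {J : _ →ₗ[ℂ] _ // IsWeilComplexStructure (stdHermitianSesqForm p q) J}) :
    graphPlane (stdWeilComplexStructureEquiv p q J).1 = Module.End.eigenspace J.1 Complex.I := by
  have h := (unitaryPeriodDomainEquiv p q).apply_symm_apply
    ⟨Module.End.eigenspace J.1 Complex.I, isPolarizingPlane_std_iff.1 (J.2.isPolarizingPlane_eigenspace)⟩
  exact congrArg Subtype.val h

/-- The standard space has complex structures of Weil type (e.g. the one with `ker(J - i) = ℂᵖ × 0`,
the image of `Z = 0`). [cite: vanGeemen1994HodgeAV, 5.5] -/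
instance nonempty_stdWeilComplexStructure :
    Nonempty {J : _ →ₗ[ℂ] _ // IsWeilComplexStructure (stdHermitianSesqForm p q) J} :=
  ⟨(stdWeilComplexStructureEquiv p q).symm ⟨0, zero_mem_unitaryPeriodDomain p q⟩⟩

end Standard

/-! ### Unitary frames: `X⁺(V, H) ≃` the type AIII domain -/

/-- A **unitary frame of signature `(p, q)`** of the Hermitian space `(V, H)`: an isometry with
the standard space `(ℂᵖ × ℂ^q, ⟪·,·⟫ ⊖ ⟪·,·⟫)` (a basis in which `H = diag(1_p, -1_q)`; exists for
`H` non-degenerate of signature `(p, q)` — Sylvester — not constructed in this file).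
[cite: GohbergLancasterRodman2005, §2.3 (2.3.8) and Thm. 2.3.2] [cite: vanGeemen1994HodgeAV, 5.4] -/
structure UnitaryFrame (H : V →ₗ⋆[ℂ] V →ₗ[ℂ] ℂ) (p q : ℕ) where
  /-- The underlying linear isomorphism `V ≅ ℂᵖ × ℂ^q`. -/
  toLinearEquiv : V ≃ₗ[ℂ] (EuclideanSpace ℂ (Fin p) × EuclideanSpace ℂ (Fin q))
  /-- It is an isometry: `H₀(e x, e y) = H(x, y)`. -/
  isometry : ∀ x y, stdHermitianSesqForm p q (toLinearEquiv x) (toLinearEquiv y) = H x y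

namespace UnitaryFrame

variable {p q : ℕ}

/-- A space with a unitary frame is Hermitian. [cite: GohbergLancasterRodman2005, §2.3] -/
theorem isSymm (F : UnitaryFrame H p q) : H.IsSymm :=
  ⟨fun x y => by rw [← F.isometry, ← F.isometry, (isSymm_stdHermitianSesqForm p q).eq]⟩

/-- The signature splitting `V = e⁻¹(ℂᵖ × 0) ⊕ e⁻¹(0 × ℂ^q)` of a unitary frame.
[cite: GohbergLancasterRodman2005, §2.3 Thm. 2.3.2] -/
def signatureSplitting (F : UnitaryFrame H p q) : SignatureSplitting H where
  pos := (stdSignatureSplitting p q).pos.comap (F.toLinearEquiv : V →ₗ[ℂ] _)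
  neg := (stdSignatureSplitting p q).neg.comap (F.toLinearEquiv : V →ₗ[ℂ] _)
  isPosDefOn_pos x hx h0 := by
    rw [← F.isometry]
    exact (stdSignatureSplitting p q).isPosDefOn_pos _ hx (by simpa using h0)
  isNegDefOn_neg x hx h0 := by
    rw [← F.isometry]
    exact (stdSignatureSplitting p q).isNegDefOn_neg _ hx (by simpa using h0)
  neg_le_orthogonalBilin x hx := by
    rw [Submodule.mem_orthogonalBilin_iff]
    intro n hn
    rw [← F.isometry]
    exact Submodule.mem_orthogonalBilin_iff.1 ((stdSignatureSplitting p q).neg_le_orthogonalBilin hx) _ hn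
  sup_eq_top := by
    rw [eq_top_iff]
    intro x _
    have hx : F.toLinearEquiv x ∈ (stdSignatureSplitting p q).pos ⊔ (stdSignatureSplitting p q).neg := by
      rw [(stdSignatureSplitting p q).sup_eq_top]
      exact Submodule.mem_top
    obtain ⟨y, hy, z, hz, hyz⟩ := Submodule.mem_sup.1 hx
    refine Submodule.mem_sup.2 ⟨F.toLinearEquiv.symm y, ?_, F.toLinearEquiv.symm z, ?_, ?_⟩
    · simpa [Submodule.mem_comap] using hy
    · simpa [Submodule.mem_comap] using hz
    · rw [← map_add, hyz, LinearEquiv.symm_apply_apply]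

/-- `dim V⁺ = p` for the splitting of a unitary frame of signature `(p, q)`.
[cite: GohbergLancasterRodman2005, §2.3 Thm. 2.3.2] -/
theorem finrank_signatureSplitting_pos (F : UnitaryFrame H p q) :
    finrank ℂ F.signatureSplitting.pos = p := by
  have h : F.signatureSplitting.pos =
      ((stdSignatureSplitting p q).pos).map (F.toLinearEquiv.symm : _ →ₗ[ℂ] V) := by
    change (stdSignatureSplitting p q).pos.comap (F.toLinearEquiv : V →ₗ[ℂ] _) = _
    exact Submodule.comap_equiv_eq_map_symm _ _
  rw [h, LinearEquiv.finrank_map_eq, finrank_stdSignatureSplitting_pos]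

/-- **Deligne's `X⁺` is the type AIII domain**: for a Hermitian space with a unitary frame of
signature `(p, q)`, the complex structures of Weil type are in canonical bijection with the open
unit ball `{Z : ℂᵖ →L ℂ^q, ‖Z‖ < 1} ≅ SU(p, q)/S(U(p) × U(q))` (`J ↦` the frame coordinates of
`ker(J - i)` as a graph). [cite: Deligne1982HodgeCycles, proof of Thm. 4.8, p. 49]
[cite: vanGeemen1994HodgeAV, 5.8–5.10] [cite: CarlsonMullerStachPeters2017, Thm. 16.1.5 (type AIII)] -/
def weilComplexStructureEquiv (F : UnitaryFrame H p q) :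
    {J : V →ₗ[ℂ] V // IsWeilComplexStructure H J} ≃ unitaryPeriodDomain p q :=
  (weilComplexStructureEquivOfIsometry F.toLinearEquiv F.isometry).trans
    (stdWeilComplexStructureEquiv p q)

/-- `X⁺ ≠ ∅`: a Hermitian space with a unitary frame carries complex structures of Weil type.
[cite: vanGeemen1994HodgeAV, 5.5] [cite: Deligne1982HodgeCycles, proof of Thm. 4.8, p. 49] -/
theorem nonempty_weilComplexStructure (F : UnitaryFrame H p q) :
    Nonempty {J : V →ₗ[ℂ] V // IsWeilComplexStructure H J} :=
  ⟨F.weilComplexStructureEquiv.symm ⟨0, zero_mem_unitaryPeriodDomain p q⟩⟩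

/-- In a framed Hermitian space of signature `(p, q)` the polarizing planes are exactly the positive
definite subspaces of dimension `p`. [cite: vanGeemen1994HodgeAV, 5.5] -/
theorem isPolarizingPlane_iff [FiniteDimensional ℂ V] (F : UnitaryFrame H p q) {W : Submodule ℂ V} :
    IsPolarizingPlane H W ↔ IsPosDefOn H W ∧ finrank ℂ W = p := by
  rw [F.signatureSplitting.isPolarizingPlane_iff_finrank_eq F.isSymm, F.finrank_signatureSplitting_pos]

end UnitaryFrame

end Literature.AlgebraicGeometry.Motives

end
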